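import Summits.Ventures.PercRepro.CorePlanes

/-!
# PercRepro — the planes with `≥ 6` points at nullity `≤ 6` (p2, gen 12)

On the coloop-free core (simple, (C1)) of nullity `≤ 6` and rank `≥ 7`, two distinct planes `P ≠ Q` with `≥ 6` points
are very constrained: their union `W = P ∪ Q` has nullity `≥ 5`, its closure has nullity `≤ 5` (nullity `6` would make
it `E`, of rank `≤ 6`), so `ν(W) = 5`, `W` is closed, `|P| = |Q| = 6`, and `L = P ∩ Q` is a `3`-point line
(`big_planes_pair`). A third such plane `R` meets `W` in `≥ 4` points (else `ν(W ∪ R) ≥ 7`), hence lies in `W`, meets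
`P` and `Q` in `3` points each and `L` in none: `R = W ∖ L` (`big_plane_third`). So there are at most three planes with
`≥ 6` points, all with exactly `6` points, and the sets of rank `≤ 3` with `≥ 5` points number at most `s₄ + 29`
(`ncard_big_sets_le_six`), exactly as at nullity `≤ 5`.

* `eRk_singleton_eq_one`, `ncard_le_eRk_of_le_two` — points have rank `1`, `≤ 2` points have nullity `0`;
* `big_planes_pair`, `big_plane_third`, **`ncard_big_sets_le_six`**.
Imports `CorePlanes`. Axioms: standard.
-/

namespace PercRepro
namespace CoreFour

open Set Finset

variable {α : Type} {M : Matroid α}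

/-- In a simple matroid with `≥ 2` points every point has rank `1`. -/
theorem eRk_singleton_eq_one [M.Finite] (hs : ∀ e ∈ M.E, ∀ f ∈ M.E, e ≠ f → M.eRk {e, f} = 2)
    (h2 : 2 ≤ M.E.ncard) {x : α} (hx : x ∈ M.E) : M.eRk {x} = 1 := by
  have hle : M.eRk {x} ≤ 1 := by
    have := M.eRk_le_encard {x}
    rwa [Set.encard_singleton] at this
  obtain ⟨y, hy, hyx⟩ := Set.exists_ne_of_one_lt_ncard (by omega : 1 < M.E.ncard) x
  have h := hs x hx y hy (Ne.symm hyx)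
  have hsub : M.eRk {x, y} ≤ M.eRk {x} + M.eRk {y} := by
    rw [Set.insert_eq]; exact M.eRk_union_le_eRk_add_eRk _ _
  have hy1 : M.eRk {y} ≤ 1 := by
    have := M.eRk_le_encard {y}
    rwa [Set.encard_singleton] at this
  rw [h] at hsub
  obtain ⟨r, hr⟩ := exists_eRk_eq_nat (M := M) {x}
  obtain ⟨r', hr'⟩ := exists_eRk_eq_nat (M := M) {y}
  rw [hr] at hle hsub ⊢
  rw [hr'] at hsub hy1
  have e1 : r ≤ 1 := by exact_mod_cast hle
  have e2 : r' ≤ 1 := by exact_mod_cast hy1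
  have e3 : 2 ≤ r + r' := by exact_mod_cast hsub
  have : r = 1 := by omega
  rw [this]; rfl

/-- A set with `≤ 2` points of a simple matroid (`|E| ≥ 2`) has nullity `0`: `|W| ≤ r(W)`. -/
theorem ncard_le_eRk_of_le_two [M.Finite] (hs : ∀ e ∈ M.E, ∀ f ∈ M.E, e ≠ f → M.eRk {e, f} = 2)
    (h2 : 2 ≤ M.E.ncard) {W : Set α} (hW : W ⊆ M.E) (hW2 : W.ncard ≤ 2) : (W.ncard : ℕ∞) ≤ M.eRk W := by
  have hWfin : W.Finite := M.ground_finite.subset hW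
  rcases Nat.lt_or_ge W.ncard 1 with h0 | h1
  · have : W.ncard = 0 := by omega
    rw [this]; simp
  rcases Nat.lt_or_ge W.ncard 2 with h1' | h2'
  · have h1'' : W.ncard = 1 := by omega
    obtain ⟨x, rfl⟩ := Set.ncard_eq_one.1 h1''
    rw [h1'', eRk_singleton_eq_one hs h2 (hW (Set.mem_singleton x))]
    exact le_refl _
  · have h := two_le_eRk_of_two_le_ncard hs hW h2'
    have : W.ncard = 2 := by omega
    rw [this]; exact h

/-- Two distinct planes (closed, rank `3`) meet in a set of rank `≤ 2`, hence (C1) of `≤ 3` points. -/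
theorem big_planes_inter [M.Finite] (hs : ∀ e ∈ M.E, ∀ f ∈ M.E, e ≠ f → M.eRk {e, f} = 2)
    (hC1 : ∀ L ⊆ M.E, M.eRk L = 2 → L.ncard ≤ 3)
    {P Q : Set α} (hPE : P ⊆ M.E) (hPr : M.eRk P = 3) (hQr : M.eRk Q = 3)
    (hPcl : M.closure P = P) (hQcl : M.closure Q = Q) (hne : P ≠ Q) :
    M.eRk (P ∩ Q) ≤ 2 ∧ (P ∩ Q).ncard ≤ 3 := by
  have hPfin : P.Finite := M.ground_finite.subset hPE
  have hIfin : (P ∩ Q).Finite := hPfin.subset Set.inter_subset_left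
  obtain ⟨rI, hrI⟩ := exists_eRk_eq_nat (M := M) (P ∩ Q)
  have hrI2 : rI ≤ 2 := by
    by_contra h
    push Not at h
    have hle : M.eRk P ≤ M.eRk (P ∩ Q) := by rw [hPr, hrI]; exact_mod_cast h
    have hle' : M.eRk Q ≤ M.eRk (P ∩ Q) := by rw [hQr, hrI]; exact_mod_cast h
    have h1 := (M.isRkFinite_of_finite hIfin).closure_eq_closure_of_subset_of_eRk_ge_eRk
      (Set.inter_subset_left : P ∩ Q ⊆ P) hle
    have h2 := (M.isRkFinite_of_finite hIfin).closure_eq_closure_of_subset_of_eRk_ge_eRk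
      (Set.inter_subset_right : P ∩ Q ⊆ Q) hle'
    rw [hPcl] at h1
    rw [hQcl] at h2
    exact hne (h1.symm.trans h2)
  refine ⟨by rw [hrI]; exact_mod_cast hrI2, ?_⟩
  by_contra h
  push Not at h
  have := three_le_eRk_of_four_le_ncard hs hC1 (Y := P ∩ Q) (Set.inter_subset_left.trans hPE) (by omega)
  rw [hrI] at this
  have : 3 ≤ rI := by exact_mod_cast this
  omega

/-- **Two distinct planes with `≥ 6` points** on the coloop-free core of nullity `≤ 6`, rank `≥ 7`: both have `6`
points, they meet in `3` points, their union is closed and has nullity exactly `5`. -/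
theorem big_planes_pair [M.Finite] (hs : ∀ e ∈ M.E, ∀ f ∈ M.E, e ≠ f → M.eRk {e, f} = 2)
    (hC1 : ∀ L ⊆ M.E, M.eRk L = 2 → L.ncard ≤ 3) (hcoloop : ∀ e, ¬ M.IsColoop e)
    {d : ℕ} (hd : M.E.encard = M.eRank + d) (hd6 : d ≤ 6) {p : ℕ} (hrank : M.eRank = (p : ℕ∞)) (hp : 7 ≤ p)
    {P Q : Set α} (hPE : P ⊆ M.E) (hQE : Q ⊆ M.E) (hPr : M.eRk P = 3) (hQr : M.eRk Q = 3)
    (hPcl : M.closure P = P) (hQcl : M.closure Q = Q) (hP6 : 6 ≤ P.ncard) (hQ6 : 6 ≤ Q.ncard) (hne : P ≠ Q) :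
    P.ncard = 6 ∧ Q.ncard = 6 ∧ (P ∩ Q).ncard = 3 ∧ M.closure (P ∪ Q) = P ∪ Q ∧
      (P ∪ Q).encard = M.eRk (P ∪ Q) + 5 := by
  have hEfin : M.E.Finite := M.ground_finite
  have hPfin : P.Finite := hEfin.subset hPE
  have hQfin : Q.Finite := hEfin.subset hQE
  have hIfin : (P ∩ Q).Finite := hPfin.subset Set.inter_subset_left
  have hWfin : (P ∪ Q).Finite := hPfin.union hQfin
  have hWE : P ∪ Q ⊆ M.E := Set.union_subset hPE hQE
  have hE2 : 2 ≤ M.E.ncard := by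
    have := Set.ncard_le_ncard hPE hEfin; omega
  obtain ⟨hrI2, hnI⟩ := big_planes_inter hs hC1 hPE hPr hQr hPcl hQcl hne
  obtain ⟨rI, hrI⟩ := exists_eRk_eq_nat (M := M) (P ∩ Q)
  obtain ⟨rW, hrW⟩ := exists_eRk_eq_nat (M := M) (P ∪ Q)
  -- the closure `F` of the union
  set F := M.closure (P ∪ Q) with hFdef
  have hFE : F ⊆ M.E := M.closure_subset_ground _
  have hFfin : F.Finite := hEfin.subset hFE
  have hWF : P ∪ Q ⊆ F := M.subset_closure _ hWE
  have hrF : M.eRk F = M.eRk (P ∪ Q) := M.eRk_closure_eq _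
  -- nullity of `F` is at most `d − 1`: nullity `d` would make `F = E`, of rank `r(P ∪ Q) ≤ 6 < p`
  have hFlt : F.ncard ≤ rW + (d - 1) := by
    have hmono := encard_le_eRk_add_of_ground hFE hd
    rw [← hFfin.cast_ncard_eq, hrF, hrW] at hmono
    have h1 : F.ncard ≤ rW + d := by exact_mod_cast hmono
    by_contra hlt
    push Not at hlt
    have hfull : F.encard = M.eRk F + d := by
      rw [← hFfin.cast_ncard_eq, hrF, hrW]
      have : F.ncard = rW + d := by omega
      rw [this]; push_cast; rfl
    have hFE' := eq_ground_of_encard_eq_eRk_add hcoloop hFE hd hfull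
    have hrE : M.eRank = (rW : ℕ∞) := by rw [← M.eRk_ground, ← hFE', hrF, hrW]
    rw [hrank] at hrE
    have hp' : p = rW := by exact_mod_cast hrE
    -- `r(P ∪ Q) ≤ r(P) + r(Q) = 6`
    have hsub := M.eRk_union_le_eRk_add_eRk P Q
    rw [hPr, hQr, hrW] at hsub
    have : rW ≤ 3 + 3 := by exact_mod_cast hsub
    omega
  have hsubm := M.eRk_inter_add_eRk_union_le P Q
  rw [hPr, hQr, hrI, hrW] at hsubm
  have e1 : rI + rW ≤ 3 + 3 := by exact_mod_cast hsubm
  have e2 : rI ≤ 2 := by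
    rw [hrI] at hrI2; exact_mod_cast hrI2
  have hIE := Set.ncard_inter_add_ncard_union P Q hPfin hQfin
  have hWleF : (P ∪ Q).ncard ≤ F.ncard := Set.ncard_le_ncard hWF hFfin
  -- nullity of the intersection: `≤ 1`, and `0` if it has `≤ 2` points
  have hν1 : (P ∩ Q).ncard ≤ rI + 1 := by
    have h := ncard_le_eRk_add_one_of_le_three hs (Set.inter_subset_left.trans hPE) hnI
    rw [hrI] at h; exact_mod_cast h
  have hν0 : (P ∩ Q).ncard ≤ 2 → (P ∩ Q).ncard ≤ rI := by
    intro h2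
    have h := ncard_le_eRk_of_le_two hs hE2 (Set.inter_subset_left.trans hPE) h2
    rw [hrI] at h; exact_mod_cast h
  have hnI3 : (P ∩ Q).ncard = 3 := by
    by_contra h
    have h2 : (P ∩ Q).ncard ≤ 2 := by omega
    have := hν0 h2
    omega
  have hrI2' : rI = 2 := by
    have := two_le_eRk_of_two_le_ncard hs (Set.inter_subset_left.trans hPE) (by omega : 2 ≤ (P ∩ Q).ncard)
    rw [hrI] at this
    have : 2 ≤ rI := by exact_mod_cast this
    omega
  have hP6' : P.ncard = 6 := by omega
  have hQ6' : Q.ncard = 6 := by omega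
  have hWF' : F = P ∪ Q := by
    symm
    apply Set.eq_of_subset_of_ncard_le hWF _ hFfin
    omega
  refine ⟨hP6', hQ6', hnI3, hWF', ?_⟩
  rw [← hWfin.cast_ncard_eq, hrW]
  have : (P ∪ Q).ncard = rW + 5 := by omega
  rw [this]; push_cast; rfl

/-- **A third plane with `≥ 6` points** is `(P ∪ Q) ∖ (P ∩ Q)`. -/
theorem big_plane_third [M.Finite] (hs : ∀ e ∈ M.E, ∀ f ∈ M.E, e ≠ f → M.eRk {e, f} = 2)
    (hC1 : ∀ L ⊆ M.E, M.eRk L = 2 → L.ncard ≤ 3) (hcoloop : ∀ e, ¬ M.IsColoop e)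
    {d : ℕ} (hd : M.E.encard = M.eRank + d) (hd6 : d ≤ 6) {p : ℕ} (hrank : M.eRank = (p : ℕ∞)) (hp : 7 ≤ p)
    {P Q R : Set α} (hPE : P ⊆ M.E) (hQE : Q ⊆ M.E) (hRE : R ⊆ M.E)
    (hPr : M.eRk P = 3) (hQr : M.eRk Q = 3) (hRr : M.eRk R = 3)
    (hPcl : M.closure P = P) (hQcl : M.closure Q = Q) (hRcl : M.closure R = R)
    (hP6 : 6 ≤ P.ncard) (hQ6 : 6 ≤ Q.ncard) (hR6 : 6 ≤ R.ncard)
    (hPQ : P ≠ Q) (hPR : P ≠ R) (hQR : Q ≠ R) : R = (P ∪ Q) \ (P ∩ Q) := by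
  have hEfin : M.E.Finite := M.ground_finite
  have hPfin : P.Finite := hEfin.subset hPE
  have hQfin : Q.Finite := hEfin.subset hQE
  have hRfin : R.Finite := hEfin.subset hRE
  have hWfin : (P ∪ Q).Finite := hPfin.union hQfin
  have hWE : P ∪ Q ⊆ M.E := Set.union_subset hPE hQE
  obtain ⟨hP6', hQ6', hnI3, hWcl, hWν⟩ := big_planes_pair hs hC1 hcoloop hd hd6 hrank hp hPE hQE hPr hQr hPcl hQcl hP6 hQ6 hPQ
  -- `R` meets `P ∪ Q` in `≥ 4` points: otherwise `ν((P ∪ Q) ∪ R) ≥ 5 + 3 − 1 = 7 > d`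
  set Z := R ∩ (P ∪ Q) with hZdef
  have hZfin : Z.Finite := hRfin.subset Set.inter_subset_left
  have hZ4 : 4 ≤ Z.ncard := by
    by_contra h
    push Not at h
    obtain ⟨rZ, hrZ⟩ := exists_eRk_eq_nat (M := M) Z
    obtain ⟨rW, hrW⟩ := exists_eRk_eq_nat (M := M) (P ∪ Q)
    obtain ⟨rT, hrT⟩ := exists_eRk_eq_nat (M := M) ((P ∪ Q) ∪ R)
    have hν := ncard_le_eRk_add_one_of_le_three hs (W := Z) (Set.inter_subset_left.trans hRE) (by omega)
    rw [hrZ] at hν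
    have e1 : Z.ncard ≤ rZ + 1 := by exact_mod_cast hν
    have hsub := M.eRk_inter_add_eRk_union_le (P ∪ Q) R
    rw [Set.inter_comm, ← hZdef, hrZ, hrW, hRr, hrT] at hsub
    have e2 : rZ + rT ≤ rW + 3 := by exact_mod_cast hsub
    have hIE := Set.ncard_inter_add_ncard_union (P ∪ Q) R hWfin hRfin
    rw [Set.inter_comm, ← hZdef] at hIE
    have hTfin : ((P ∪ Q) ∪ R).Finite := hWfin.union hRfin
    have hmono := encard_le_eRk_add_of_ground (Set.union_subset hWE hRE) hd
    rw [← hTfin.cast_ncard_eq, hrT] at hmono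
    have e3 : ((P ∪ Q) ∪ R).ncard ≤ rT + d := by exact_mod_cast hmono
    have e4 : (P ∪ Q).ncard = rW + 5 := by
      rw [← hWfin.cast_ncard_eq, hrW] at hWν
      exact_mod_cast hWν
    omega
  -- hence `R ⊆ P ∪ Q`
  have hRW : R ⊆ P ∪ Q := by
    have hZR : Z ⊆ R := Set.inter_subset_left
    have hZr : 3 ≤ M.eRk Z := three_le_eRk_of_four_le_ncard hs hC1 (hZR.trans hRE) hZ4
    have hle : M.eRk R ≤ M.eRk Z := by rw [hRr]; exact hZr
    have h1 := (M.isRkFinite_of_finite hZfin).closure_eq_closure_of_subset_of_eRk_ge_eRk hZR hle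
    rw [hRcl] at h1
    rw [← h1, ← hWcl]
    exact M.closure_subset_closure Set.inter_subset_right
  obtain ⟨_, hRP⟩ := big_planes_inter hs hC1 hRE hRr hPr hRcl hPcl hPR.symm
  obtain ⟨_, hRQ⟩ := big_planes_inter hs hC1 hRE hRr hQr hRcl hQcl hQR.symm
  have hRsplit : R = (R ∩ P) ∪ (R ∩ Q) := by
    rw [← Set.inter_union_distrib_left, Set.inter_eq_left.2 hRW]
  have hfinRP : (R ∩ P).Finite := hRfin.subset Set.inter_subset_left
  have hfinRQ : (R ∩ Q).Finite := hRfin.subset Set.inter_subset_left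
  have hIE := Set.ncard_union_add_ncard_inter (R ∩ P) (R ∩ Q) hfinRP hfinRQ
  rw [← hRsplit] at hIE
  have hRP3 : (R ∩ P).ncard = 3 := by omega
  have hRQ3 : (R ∩ Q).ncard = 3 := by omega
  have hRL0 : ((R ∩ P) ∩ (R ∩ Q)).ncard = 0 := by omega
  have hRL : (R ∩ P) ∩ (R ∩ Q) = ∅ := (Set.ncard_eq_zero (hfinRP.subset Set.inter_subset_left)).1 hRL0
  -- `R ∩ P = P ∖ (P ∩ Q)` (both have `3` points, the former avoids `P ∩ Q`)
  have hRPsub : R ∩ P ⊆ P \ (P ∩ Q) := by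
    intro x hx
    refine ⟨hx.2, fun hxI => ?_⟩
    have : x ∈ (R ∩ P) ∩ (R ∩ Q) := ⟨hx, ⟨hx.1, hxI.2⟩⟩
    rw [hRL] at this
    exact this
  have hRQsub : R ∩ Q ⊆ Q \ (P ∩ Q) := by
    intro x hx
    refine ⟨hx.2, fun hxI => ?_⟩
    have : x ∈ (R ∩ P) ∩ (R ∩ Q) := ⟨⟨hx.1, hxI.1⟩, hx⟩
    rw [hRL] at this
    exact this
  have hPdiff : (P \ (P ∩ Q)).ncard = 3 := by
    rw [Set.ncard_sdiff Set.inter_subset_left (hPfin.subset Set.inter_subset_left), hP6', hnI3]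
  have hQdiff : (Q \ (P ∩ Q)).ncard = 3 := by
    rw [Set.ncard_sdiff Set.inter_subset_right (hPfin.subset Set.inter_subset_left), hQ6', hnI3]
  have hRPeq : R ∩ P = P \ (P ∩ Q) :=
    Set.eq_of_subset_of_ncard_le hRPsub (by omega) (hPfin.subset Set.sdiff_subset)
  have hRQeq : R ∩ Q = Q \ (P ∩ Q) :=
    Set.eq_of_subset_of_ncard_le hRQsub (by omega) (hQfin.subset Set.sdiff_subset)
  rw [hRsplit, hRPeq, hRQeq, ← Set.union_sdiff_distrib]

/-- **The sets of rank `≤ 3` with `≥ 5` points number at most `s₄ + 29`** on the coloop-free core of nullity `≤ 6`,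
rank `≥ 7`, with (C2): as in `ncard_big_sets_le`, but the planes with `≥ 6` points are at most three and, when there are
at least two, all have exactly `6` points (`≤ 7` subsets with `≥ 5` points each). -/
theorem ncard_big_sets_le_six [M.Finite] (hs : ∀ e ∈ M.E, ∀ f ∈ M.E, e ≠ f → M.eRk {e, f} = 2)
    (hC1 : ∀ L ⊆ M.E, M.eRk L = 2 → L.ncard ≤ 3) (hC2 : ∀ P ⊆ M.E, M.eRk P = 3 → P.ncard ≤ 7)
    (hcoloop : ∀ e, ¬ M.IsColoop e) {d : ℕ} (hd : M.E.encard = M.eRank + d) (hd6 : d ≤ 6)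
    {p : ℕ} (hrank : M.eRank = (p : ℕ∞)) (hp : 7 ≤ p) :
    {X : Set α | X ⊆ M.E ∧ M.eRk X ≤ 3 ∧ 5 ≤ X.ncard}.ncard ≤ (PercRepro.Matroid.circuitsEq M 4).ncard + 29 := by
  classical
  have h4fin : (PercRepro.Matroid.circuitsEq M 4).Finite := PercRepro.Matroid.circuitsEq_finite 4
  set F₄ := h4fin.toFinset with hF₄
  set Pl := F₄.image (fun C => M.closure C) with hPldef
  have hEsub : {X : Set α | X ⊆ M.E}.Finite := M.ground_finite.finite_subsets
  let g : Set α → Finset (Set α) := fun P => hEsub.toFinset.filter (fun X => X ⊆ P ∧ 5 ≤ X.ncard)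
  have hcirc_rank : ∀ C, M.IsCircuit C → C.ncard = 4 → M.eRk C = 3 := by
    intro C hC hC4
    have hCfin : C.Finite := M.ground_finite.subset hC.subset_ground
    have h := hC.eRk_add_one_eq
    rw [← hCfin.cast_ncard_eq, hC4] at h
    obtain ⟨r, hr⟩ := exists_eRk_eq_nat (M := M) C
    rw [hr] at h ⊢
    have : r + 1 = 4 := by exact_mod_cast h
    have : r = 3 := by omega
    rw [this]; rfl
  have hPl : ∀ P ∈ Pl, P ⊆ M.E ∧ M.eRk P = 3 ∧ M.closure P = P ∧ P.ncard ≤ 7 := by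
    intro P hP
    rw [hPldef, Finset.mem_image] at hP
    obtain ⟨C, hC, rfl⟩ := hP
    rw [hF₄, Set.Finite.mem_toFinset] at hC
    have hclr : M.eRk (M.closure C) = 3 := by rw [M.eRk_closure_eq]; exact hcirc_rank C hC.1 hC.2
    exact ⟨M.closure_subset_ground C, hclr, M.closure_closure C, hC2 _ (M.closure_subset_ground C) hclr⟩
  have hcover : {X : Set α | X ⊆ M.E ∧ M.eRk X ≤ 3 ∧ 5 ≤ X.ncard} ⊆ ↑(Pl.biUnion g) := by
    rintro X ⟨hXE, hXr, hX5⟩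
    obtain ⟨Y, hYX, hY5⟩ := Set.exists_subset_card_eq hX5
    have hYE : Y ⊆ M.E := hYX.trans hXE
    obtain ⟨C, hCY, hC, hC4⟩ := exists_isCircuit_four_of_five hs hC1 hYE hY5 ((M.eRk_mono hYX).trans hXr)
    have hCX : C ⊆ X := hCY.trans hYX
    have hCfin : C.Finite := M.ground_finite.subset hC.subset_ground
    have hCr : M.eRk C = 3 := hcirc_rank C hC hC4
    have hcl : M.closure C = M.closure X :=
      (M.isRkFinite_of_finite hCfin).closure_eq_closure_of_subset_of_eRk_ge_eRk hCX (by rw [hCr]; exact hXr)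
    have hXcl : X ⊆ M.closure C := by rw [hcl]; exact M.subset_closure X hXE
    rw [Finset.mem_coe, Finset.mem_biUnion]
    refine ⟨M.closure C, ?_, ?_⟩
    · rw [hPldef, Finset.mem_image]
      exact ⟨C, by rw [hF₄, Set.Finite.mem_toFinset]; exact ⟨hC, hC4⟩, rfl⟩
    · simp only [g, Finset.mem_filter, Set.Finite.mem_toFinset, Set.mem_setOf_eq]
      exact ⟨hXE, hXcl, hX5⟩
  have hg : ∀ P ∈ Pl, (g P).card ≤ {X : Set α | X ⊆ P ∧ 5 ≤ X.ncard}.ncard := by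
    intro P hP
    have hPE := (hPl P hP).1
    have hfinS : {X : Set α | X ⊆ P ∧ 5 ≤ X.ncard}.Finite := hEsub.subset (fun X hX => hX.1.trans hPE)
    have hsub : (↑(g P) : Set (Set α)) ⊆ {X : Set α | X ⊆ P ∧ 5 ≤ X.ncard} := by
      intro X hX
      simp only [g, Finset.coe_filter, Set.Finite.mem_toFinset, Set.mem_setOf_eq] at hX
      exact ⟨hX.2.1, hX.2.2⟩
    have := Set.ncard_le_ncard hsub hfinS
    rwa [Set.ncard_coe_finset] at this
  have hbig29 : ∀ P ∈ Pl, (g P).card ≤ 29 := by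
    intro P hP
    exact (hg P hP).trans (ncard_subsets_five_le_le (M.ground_finite.subset (hPl P hP).1) (hPl P hP).2.2.2)
  have hsmall : ∀ P ∈ Pl, P.ncard ≤ 5 → (g P).card ≤ 1 := by
    intro P hP h5
    exact (hg P hP).trans (ncard_subsets_five_le_le_one (M.ground_finite.subset (hPl P hP).1) h5)
  have hsix : ∀ P ∈ Pl, P.ncard = 6 → (g P).card ≤ 7 := by
    intro P hP h6
    have h := (hg P hP).trans (ncard_subsets_five_le_le_choose (M.ground_finite.subset (hPl P hP).1) (by omega))
    rw [h6] at h
    norm_num [Nat.choose] at h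
    exact h
  set big := Pl.filter (fun Q => 6 ≤ Q.ncard) with hbigdef
  set small := Pl.filter (fun Q => ¬ 6 ≤ Q.ncard) with hsmalldef
  have hsplit : (∑ P ∈ big, (g P).card) + ∑ P ∈ small, (g P).card = ∑ P ∈ Pl, (g P).card := by
    rw [hbigdef, hsmalldef]
    exact Finset.sum_filter_add_sum_filter_not Pl (fun Q => 6 ≤ Q.ncard) (fun P => (g P).card)
  -- the planes with `≥ 6` points: at most three, all with `6` points if at least two
  have hbigmem : ∀ P ∈ big, P ⊆ M.E ∧ M.eRk P = 3 ∧ M.closure P = P ∧ 6 ≤ P.ncard := by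
    intro P hP
    rw [hbigdef, Finset.mem_filter] at hP
    exact ⟨(hPl P hP.1).1, (hPl P hP.1).2.1, (hPl P hP.1).2.2.1, hP.2⟩
  have hA : ∑ P ∈ big, (g P).card ≤ 29 := by
    rcases Nat.lt_or_ge big.card 2 with hlt | hge
    · calc ∑ P ∈ big, (g P).card ≤ ∑ _P ∈ big, 29 :=
            Finset.sum_le_sum (fun P hP => hbig29 P (Finset.mem_filter.1 hP).1)
        _ = big.card * 29 := by rw [Finset.sum_const, smul_eq_mul]
        _ ≤ 1 * 29 := Nat.mul_le_mul_right _ (by omega)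
        _ = 29 := by norm_num
    · -- every plane of `big` has exactly `6` points
      have h6 : ∀ P ∈ big, P.ncard = 6 := by
        intro P hP
        obtain ⟨a, ha, b, hb, hab⟩ := Finset.one_lt_card.1 (by omega : 1 < big.card)
        obtain ⟨Q, hQ, hQP⟩ : ∃ Q ∈ big, Q ≠ P := by
          by_cases haP : a = P
          · exact ⟨b, hb, fun h => hab (haP.trans h.symm)⟩
          · exact ⟨a, ha, haP⟩
        obtain ⟨hPE, hPr, hPcl, hP6⟩ := hbigmem P hP
        obtain ⟨hQE, hQr, hQcl, hQ6⟩ := hbigmem Q hQ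
        exact (big_planes_pair hs hC1 hcoloop hd hd6 hrank hp hPE hQE hPr hQr hPcl hQcl hP6 hQ6
          (Ne.symm hQP)).1
      -- at most three of them
      have hcard3 : big.card ≤ 3 := by
        by_contra h
        push Not at h
        rw [Finset.three_lt_card_iff] at h
        obtain ⟨P, Q, R, R', hP, hQ, hR, hR', hPQ, hPR, hPR', hQR, hQR', hRR'⟩ := h
        obtain ⟨hPE, hPr, hPcl, hP6⟩ := hbigmem P hP
        obtain ⟨hQE, hQr, hQcl, hQ6⟩ := hbigmem Q hQ
        obtain ⟨hRE, hRr, hRcl, hR6⟩ := hbigmem R hR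
        obtain ⟨hR'E, hR'r, hR'cl, hR'6⟩ := hbigmem R' hR'
        have e1 := big_plane_third hs hC1 hcoloop hd hd6 hrank hp hPE hQE hRE hPr hQr hRr hPcl hQcl hRcl
          hP6 hQ6 hR6 hPQ hPR hQR
        have e2 := big_plane_third hs hC1 hcoloop hd hd6 hrank hp hPE hQE hR'E hPr hQr hR'r hPcl hQcl hR'cl
          hP6 hQ6 hR'6 hPQ hPR' hQR'
        exact hRR' (e1.trans e2.symm)
      calc ∑ P ∈ big, (g P).card ≤ ∑ _P ∈ big, 7 :=
            Finset.sum_le_sum (fun P hP => hsix P (Finset.mem_filter.1 hP).1 (h6 P hP))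
        _ = big.card * 7 := by rw [Finset.sum_const, smul_eq_mul]
        _ ≤ 3 * 7 := Nat.mul_le_mul_right _ hcard3
        _ ≤ 29 := by norm_num
  have hB : ∑ P ∈ small, (g P).card ≤ (PercRepro.Matroid.circuitsEq M 4).ncard := by
    calc ∑ P ∈ small, (g P).card ≤ ∑ _P ∈ small, 1 :=
          Finset.sum_le_sum (fun P hP => hsmall P (Finset.mem_filter.1 hP).1 (by
            have := (Finset.mem_filter.1 hP).2; omega))
      _ = small.card := by rw [Finset.sum_const, smul_eq_mul, mul_one]
      _ ≤ Pl.card := Finset.card_filter_le _ _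
      _ ≤ F₄.card := Finset.card_image_le
      _ = (PercRepro.Matroid.circuitsEq M 4).ncard := by rw [hF₄, ← Set.ncard_eq_toFinset_card _ h4fin]
  calc {X : Set α | X ⊆ M.E ∧ M.eRk X ≤ 3 ∧ 5 ≤ X.ncard}.ncard
      ≤ (↑(Pl.biUnion g) : Set (Set α)).ncard := Set.ncard_le_ncard hcover (Finset.finite_toSet _)
    _ = (Pl.biUnion g).card := Set.ncard_coe_finset _
    _ ≤ ∑ P ∈ Pl, (g P).card := Finset.card_biUnion_le
    _ = (∑ P ∈ big, (g P).card) + ∑ P ∈ small, (g P).card := hsplit.symm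
    _ ≤ 29 + (PercRepro.Matroid.circuitsEq M 4).ncard := Nat.add_le_add hA hB
    _ = _ := by ring

end CoreFour
end PercRepro
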